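import Summits.Ventures.Crystal3D.Theorems.StickyWulffConstantNoReconstructionGainGrainFrameThreeHighB
import Summits.Ventures.Crystal3D.Theorems.StickyWulffConstantNoReconstructionGainGrainFrameThreeRegimeI
import HarnessLib

/-!
# The three-contact cap budget: the regime above the second depth, and the assembled core

HONEST FRAMING. Part of the venture `Summits/Ventures/Crystal3D` (cell `crystal3d-full`), helper
`--supports` the crux `NoReconstructionGain` (stmt-Ventures-19144, route
`route-Ventures-StickyWulffConstant`), line `adhesion` (wulff-p1 g12); a brick of the open stub
`stub_frameCapBudget` (skeleton v15), case of three substrate contacts.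

Coordinates and the credit interface `Cr`, `Lv` as in `…GrainFrameThreeRegimeI`.

* `capBudget_three_high` — the regime `2t > a+c`: `(a+c)² < 8/3` (else three pairwise
  non-overlapping contacts do not fit, `triple_cap` with `m = S`), the vertex step when a contact is
  `d₁`, and otherwise the dispatch over the eight blocked pairs of `spl2_coords` for the first contact
  (`high_P12 … high_P46`, files `…ThreeHighA/B`).
* `capBudget_three_core` — **the whole three-contact budget in coordinates**: `2t ≤ max(a+b, c−a)`
  (three steep directions), the first regime (`…ThreeRegimeI`), or the high regime.

WHAT THIS IS NOT: the translation back to the moved bond star `A U₀` and the stub by name (next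
file); rung F-C1 not moved.
-/

namespace Summit.Ventures.Crystal3D.Theorems

section core
variable {a b c T x₁ y₁ z₁ x₂ y₂ z₂ x₃ y₃ z₃ : ℝ} {Cr Lv : ℤ × ℤ × ℤ → Prop}
  (ha : 0 ≤ a) (hab : a ≤ b) (hbc : b ≤ c) (hS : a ^ 2 + b ^ 2 + c ^ 2 = 2)
  (hu₁ : x₁ ^ 2 + y₁ ^ 2 + z₁ ^ 2 = 2) (hu₂ : x₂ ^ 2 + y₂ ^ 2 + z₂ ^ 2 = 2)
  (hu₃ : x₃ ^ 2 + y₃ ^ 2 + z₃ ^ 2 = 2)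
  (h12 : x₁ * x₂ + y₁ * y₂ + z₁ * z₂ ≤ 1) (h13 : x₁ * x₃ + y₁ * y₃ + z₁ * z₃ ≤ 1)
  (h23 : x₂ * x₃ + y₂ * y₃ + z₂ * z₃ ≤ 1)
  (hδ₁ : T ≤ a * x₁ + b * y₁ + c * z₁) (hδ₂ : T ≤ a * x₂ + b * y₂ + c * z₂)
  (hδ₃ : T ≤ a * x₃ + b * y₃ + c * z₃)
  (hCr : ∀ (k i j : ℤ) (e₁ e₂ e₃ : ℝ), e₁ = i + j → e₂ = k + i → e₃ = k + j →
    i ^ 2 + j ^ 2 + k ^ 2 + i * j + i * k + j * k = 1 → 0 < e₁ * a + e₂ * b + e₃ * c →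
    (1 < e₁ * x₁ + e₂ * y₁ + e₃ * z₁ ∨ 1 < e₁ * x₂ + e₂ * y₂ + e₃ * z₂ ∨ 1 < e₁ * x₃ + e₂ * y₃ + e₃ * z₃ ∨
      T ≤ e₁ * a + e₂ * b + e₃ * c) → Cr (k, i, j))
  (hLv : ∀ (k i j : ℤ) (e₁ e₂ e₃ : ℝ), e₁ = i + j → e₂ = k + i → e₃ = k + j →
    i ^ 2 + j ^ 2 + k ^ 2 + i * j + i * k + j * k = 1 → e₁ * a + e₂ * b + e₃ * c = 0 →
    (1 < e₁ * x₁ + e₂ * y₁ + e₃ * z₁ ∨ 1 < e₁ * x₂ + e₂ * y₂ + e₃ * z₂ ∨ 1 < e₁ * x₃ + e₂ * y₃ + e₃ * z₃) →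
    Lv (k, i, j))
include ha hab hbc hS hu₁ hu₂ hu₃ h12 h13 h23 hδ₁ hδ₂ hδ₃ hCr

set_option maxHeartbeats 800000 in
/-- **The three-contact cap budget in the regime `2t > a+c`.**  See the module docstring. -/
theorem capBudget_three_high (hTh : a + c < T) :
    ∃ p₁ p₂ p₃ : ℤ × ℤ × ℤ, p₁ ≠ p₂ ∧ p₁ ≠ p₃ ∧ p₂ ≠ p₃ ∧ Cr p₁ ∧ Cr p₂ ∧ Cr p₃ := by
  have hc : 0 < c := by nlinarith
  have hd₁ : a + c < a * x₁ + b * y₁ + c * z₁ := lt_of_lt_of_le hTh hδ₁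
  have hd₂ : a + c < a * x₂ + b * y₂ + c * z₂ := lt_of_lt_of_le hTh hδ₂
  have hd₃ : a + c < a * x₃ + b * y₃ + c * z₃ := lt_of_lt_of_le hTh hδ₃
  -- three pairwise non-overlapping contacts deeper than `a + c` force `(a+c)² < 8/3`
  have hac83 : (a + c) ^ 2 < 8 / 3 := by
    by_contra h; push Not at h
    have hpos : 0 ≤ a + c := by linarith
    have hsum : 3 * (a + c) ≤
        (a * x₁ + b * y₁ + c * z₁) + (a * x₂ + b * y₂ + c * z₂) + (a * x₃ + b * y₃ + c * z₃) := by linarith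
    have hsq : 9 * (a + c) ^ 2 ≤
        ((a * x₁ + b * y₁ + c * z₁) + (a * x₂ + b * y₂ + c * z₂) + (a * x₃ + b * y₃ + c * z₃)) ^ 2 := by
      nlinarith
    have hlt : (a + c) ^ 2 < (a * x₁ + b * y₁ + c * z₁) * (a + c) := by nlinarith
    exact triple_cap (m₁ := a) (m₂ := b) (m₃ := c) hu₁ hu₂ hu₃ h12 h13 h23 (by nlinarith)
  have hac : a < c := by
    by_contra h; push Not at h
    have h1 : a = c := le_antisymm (le_trans hab hbc) h
    have h2 : b = c := le_antisymm hbc (h1 ▸ hab)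
    rw [h1, h2] at hS; rw [h1] at hac83
    nlinarith
  -- credit introduction per contact
  have hCr₁ : ∀ (k i j : ℤ) (e₁ e₂ e₃ : ℝ), e₁ = i + j → e₂ = k + i → e₃ = k + j →
      i ^ 2 + j ^ 2 + k ^ 2 + i * j + i * k + j * k = 1 → 0 < e₁ * a + e₂ * b + e₃ * c →
      1 < e₁ * x₁ + e₂ * y₁ + e₃ * z₁ → Cr (k, i, j) :=
    fun k i j e₁ e₂ e₃ h₁ h₂ h₃ hn hp hb => hCr k i j e₁ e₂ e₃ h₁ h₂ h₃ hn hp (Or.inl hb)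
  have hCr₂ : ∀ (k i j : ℤ) (e₁ e₂ e₃ : ℝ), e₁ = i + j → e₂ = k + i → e₃ = k + j →
      i ^ 2 + j ^ 2 + k ^ 2 + i * j + i * k + j * k = 1 → 0 < e₁ * a + e₂ * b + e₃ * c →
      1 < e₁ * x₂ + e₂ * y₂ + e₃ * z₂ → Cr (k, i, j) :=
    fun k i j e₁ e₂ e₃ h₁ h₂ h₃ hn hp hb => hCr k i j e₁ e₂ e₃ h₁ h₂ h₃ hn hp (Or.inr (Or.inl hb))
  have hCr₃ : ∀ (k i j : ℤ) (e₁ e₂ e₃ : ℝ), e₁ = i + j → e₂ = k + i → e₃ = k + j →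
      i ^ 2 + j ^ 2 + k ^ 2 + i * j + i * k + j * k = 1 → 0 < e₁ * a + e₂ * b + e₃ * c →
      1 < e₁ * x₃ + e₂ * y₃ + e₃ * z₃ → Cr (k, i, j) :=
    fun k i j e₁ e₂ e₃ h₁ h₂ h₃ hn hp hb => hCr k i j e₁ e₂ e₃ h₁ h₂ h₃ hn hp (Or.inr (Or.inr (Or.inl hb)))
  have cD1 := hCr 1 0 0 0 1 1 (by norm_num) (by norm_num) (by norm_num) (by norm_num) (by linarith)
  -- Step 1: a contact is the vertex `d₁`
  by_cases hv₁ : x₁ = 0 ∧ y₁ = 1 ∧ z₁ = 1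
  · obtain ⟨e1, e2, e3⟩ := hv₁
    have C1 : Cr (1, 0, 0) := cD1 (Or.inl (by rw [e1, e2, e3]; norm_num))
    have hnb : y₂ + z₂ ≤ 1 := by have h := h12; rw [e1, e2, e3] at h; linarith
    exact high_vertex_step ha hab hbc hS hu₂ hd₂ hnb C1 hCr₂
  by_cases hv₂ : x₂ = 0 ∧ y₂ = 1 ∧ z₂ = 1
  · obtain ⟨e1, e2, e3⟩ := hv₂
    have C1 : Cr (1, 0, 0) := cD1 (Or.inr (Or.inl (by rw [e1, e2, e3]; norm_num)))
    have hnb : y₁ + z₁ ≤ 1 := by have h := h12; rw [e1, e2, e3] at h; linarith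
    exact high_vertex_step ha hab hbc hS hu₁ hd₁ hnb C1 hCr₁
  by_cases hv₃ : x₃ = 0 ∧ y₃ = 1 ∧ z₃ = 1
  · obtain ⟨e1, e2, e3⟩ := hv₃
    have C1 : Cr (1, 0, 0) := cD1 (Or.inr (Or.inr (Or.inl (by rw [e1, e2, e3]; norm_num))))
    have hnb : y₁ + z₁ ≤ 1 := by have h := h13; rw [e1, e2, e3] at h; linarith
    exact high_vertex_step ha hab hbc hS hu₁ hd₁ hnb C1 hCr₁
  -- Step 2: credited blocked pairs of contacts 2 and 3, and dispatch on the pair of contact 1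
  obtain ⟨q₂, q₂', hq₂, Cq₂, Cq₂', Bq₂, Bq₂'⟩ := spl2_pack ha hab hbc hS hu₂ hd₂ hCr₂ hv₂
  obtain ⟨q₃, q₃', hq₃, Cq₃, Cq₃', Bq₃, Bq₃'⟩ := spl2_pack ha hab hbc hS hu₃ hd₃ hCr₃ hv₃
  rcases spl2_coords ha hab hbc hS hu₁ hd₁ hv₁ with
    ⟨h1, h2⟩ | ⟨h1, h2, -⟩ | ⟨h1, h2, h3⟩ | ⟨h1, h2, -, h4⟩ | ⟨h1, h2, h3⟩ | ⟨h1, h2, h3⟩ | ⟨h1, h2, h3⟩ |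
      ⟨h1, h2, h3, -⟩
  · exact high_P12 ha hab hc hac hu₁ hu₂ hu₃ h12 h13 h23 hd₁ hd₂ hd₃ hCr hq₂ Cq₂ Cq₂' Bq₂ Bq₂' hq₃ Cq₃ Cq₃'
      Bq₃ Bq₃' h1 h2
  · exact high_P14 ha hab hc hac hu₁ hu₂ hu₃ h12 h13 h23 hd₁ hd₂ hd₃ hCr hq₂ Cq₂ Cq₂' Bq₂ Bq₂' hq₃ Cq₃ Cq₃'
      Bq₃ Bq₃' h1 h2
  · exact high_P25 ha hab hc hac hu₁ hu₂ hu₃ h12 h13 h23 hd₁ hd₂ hd₃ hCr hq₂ Cq₂ Cq₂' Bq₂ Bq₂' hq₃ Cq₃ Cq₃'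
      Bq₃ Bq₃' h1 h2 h3
  · exact high_P45 ha hab hc hac hu₁ hu₂ hu₃ h12 h13 h23 hd₁ hd₂ hd₃ hCr hq₂ Cq₂ Cq₂' Bq₂ Bq₂' hq₃ Cq₃ Cq₃'
      Bq₃ Bq₃' h1 h2 h4
  · exact high_P13 ha hab hbc hc hac hu₁ hu₂ hu₃ h12 h13 h23 hd₁ hd₂ hd₃ hCr hq₂ Cq₂ Cq₂' Bq₂ Bq₂' hq₃ Cq₃
      Cq₃' Bq₃ Bq₃' h1 h2 h3
  · exact high_P16 ha hc hac hu₁ hu₂ hu₃ h12 h13 h23 hCr hq₂ Cq₂ Cq₂' Bq₂ Bq₂' hq₃ Cq₃ Cq₃' Bq₃ Bq₃' h1 h2 h3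
  · exact high_P23 ha hab hbc hc hac hu₁ hu₂ hu₃ h12 h13 h23 hδ₁ hδ₂ hδ₃ hCr hq₂ Cq₂ Cq₂' Bq₂ Bq₂' hq₃ Cq₃
      Cq₃' Bq₃ Bq₃' h1 h2 h3
  · exact high_P46 ha hab hc hac hu₁ hu₂ hu₃ h12 h13 h23 hδ₁ hδ₂ hδ₃ hCr hq₂ Cq₂ Cq₂' Bq₂ Bq₂' hq₃ Cq₃ Cq₃'
      Bq₃ Bq₃' h1 h2 h3

include hLv in
set_option maxHeartbeats 400000 in
/-- **The three-contact cap budget in coordinates** (all regimes): three distinct credited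
strictly-down directions, or two of them and two blocked level directions. -/
theorem capBudget_three_core (hT0 : 0 < T) :
    (∃ p₁ p₂ p₃ : ℤ × ℤ × ℤ, p₁ ≠ p₂ ∧ p₁ ≠ p₃ ∧ p₂ ≠ p₃ ∧ Cr p₁ ∧ Cr p₂ ∧ Cr p₃) ∨
    (∃ p₁ p₂ l₁ l₂ : ℤ × ℤ × ℤ, p₁ ≠ p₂ ∧ l₁ ≠ l₂ ∧ Cr p₁ ∧ Cr p₂ ∧ Lv l₁ ∧ Lv l₂) := by
  have hc : 0 < c := by nlinarith
  have cD1 := hCr 1 0 0 0 1 1 (by norm_num) (by norm_num) (by norm_num) (by norm_num) (by linarith)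
  have cD2 := hCr 0 0 1 1 0 1 (by norm_num) (by norm_num) (by norm_num) (by norm_num) (by linarith)
  by_cases hlow : T ≤ max (a + b) (c - a)
  · -- three steep directions
    have C1 : Cr (1, 0, 0) :=
      cD1 (Or.inr (Or.inr (Or.inr (by linarith [max_le (by linarith : a + b ≤ b + c) (by linarith : c - a ≤ b + c)]))))
    have C2 : Cr (0, 0, 1) :=
      cD2 (Or.inr (Or.inr (Or.inr (by linarith [max_le (by linarith : a + b ≤ a + c) (by linarith : c - a ≤ a + c)]))))
    rcases le_total (c - a) (a + b) with h | h
    · rw [max_eq_left h] at hlow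
      exact Or.inl ⟨(1, 0, 0), (0, 0, 1), (0, 1, 0), by decide, by decide, by decide, C1, C2,
        hCr 0 1 0 1 1 0 (by norm_num) (by norm_num) (by norm_num) (by norm_num) (by linarith)
          (Or.inr (Or.inr (Or.inr (by linarith))))⟩
    · rw [max_eq_right h] at hlow
      exact Or.inl ⟨(1, 0, 0), (0, 0, 1), (1, -1, 0), by decide, by decide, by decide, C1, C2,
        hCr 1 (-1) 0 (-1) 0 1 (by norm_num) (by norm_num) (by norm_num) (by norm_num) (by linarith)
          (Or.inr (Or.inr (Or.inr (by linarith))))⟩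
  · push Not at hlow
    have hT3 : a + b < T := lt_of_le_of_lt (le_max_left _ _) hlow
    have hT4 : c - a < T := lt_of_le_of_lt (le_max_right _ _) hlow
    by_cases hTI : T ≤ a + c
    · exact capBudget_three_regimeI hab hS hu₁ hu₂ hu₃ h12 h13 h23 hT3 hT4 hδ₁ hδ₂ hδ₃ hCr hLv hTI
    · push Not at hTI
      exact Or.inl (capBudget_three_high ha hab hbc hS hu₁ hu₂ hu₃ h12 h13 h23 hδ₁ hδ₂ hδ₃ hCr hTI)

end core

end Summit.Ventures.Crystal3D.Theorems
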